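import Literature.AlgebraicGeometry.Modules.LocallyFreeTrace
import Literature.AlgebraicGeometry.HodgeTheory.AtiyahClass
import Mathlib.Algebra.Homology.DerivedCategory.Ext.Map
import HarnessLib

/-!
# `AtiyahClassTraceReal`: the real trace `Tr : Extⁱ(E, E) → Hⁱ(X, 𝒪_X)` and the semiregularity
# components `σ_0`, `σ_1` of a finite locally free module, on Mathlib's `Ext`

For a finite locally free `𝒪_X`-module `E` (`Motives.IsFiniteLocallyFree E`) on a scheme `X`
(for `σ_1`: an `S`-scheme `X : Over (Spec S)`, e.g. `S = k` perfect or `S = W_n(k)`) we CONSTRUCT —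
no hypothesis structures, no named facts —

* `extToCohomology G i : Extⁱ_{𝒪_X}(𝒪_X, G) → Hⁱ(X, G)` (forget to abelian sheaves — an exact
  functor, `preservesFiniteColimits_modulesToSheaf` — and precompose with `1 : ℤ_X → 𝒪_X`;
  the comparison of Hartshorne III.2.6 / III.6.3 (c));
* `traceExtCoeff hE G i : Extⁱ(E, 𝓗om(E^∨, G)) → Extⁱ(𝒪_X, G)` and
  `traceExt hE i : Extⁱ(E, E) → Extⁱ(𝒪_X, 𝒪_X)` — Illusie's / Buchweitz–Flenner's trace
  `Tr : Ext^k(F, F ⊗ G) → H^k(X, G)` for a vector bundle `F`: apply the EXACT functor `𝓗om(E, –)`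
  (Mathlib `Ext.mapExactFunctor`; exactness is `Modules/SheafHomExact.lean`), precompose with the
  unit `𝒪_X → 𝓔nd(E)` and post-compose with the contraction / trace of
  `Modules/LocallyFreeTrace.lean`;
* `traceToCohomology hE i : Extⁱ(E, E) → Hⁱ(X, 𝒪_X) = Motives.structureSheafCohomology X i`;
* `sigmaZero hE = Tr : Ext²(E, E) → H²(X, 𝒪_X)` and
  `sigmaOne hE : Ext²(E, E) → H³(X, Ω¹_{X/S}) = Motives.hodgeCohomologyOne X 3`,
  `σ_1(x) = Tr_{Ω¹}(x ∘ At(E))` (`sigmaOne_apply`) — the form-degree `0` and `1` components of the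
  Buchweitz–Flenner semiregularity map `σ = Tr(∗ · exp(-At(F))) : Ext²_X(F, F) → ∏ H^{k+2}(X, Λ^k 𝕃)`
  (Def. 4.1), up to the sign `(-1)^k` of `exp(-At)` (irrelevant for injectivity);
* `IsZeroSemiregular`, `IsOneSemiregular`, `IsZeroOneSemiregular` — injectivity of `σ_0`, `σ_1`,
  `(σ_0, σ_1)` ("`k`-semiregular: the component `σ_k` … is injective", BF §1; `I`-semiregular, §5).

These are the ANCHORED, DEFINED maps the interface `HodgeTheory.SemiregularityMap` (where `σ` is
data of a hypothesis structure `AtiyahTraceAlgebra`) asks its intended instance to provide, for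
`(i, j) ∈ {(2, 0), (3, 1)}`: `Ext²(E, E)` is Mathlib's, the targets are the tree's real Hodge
cohomology groups. Requested by route `HodgeConjecture/PadicSemiregularLift` (crux
`PadicPridhamSemiregularity`: "p-adically semiregular ⇒ class-lifts-imply-object-lifts").

## Not here

`σ_q` for `q ≥ 2` (needs `Ω^q = Λ^q Ω¹`, `defn-HodgeSheavesOmega`, and the Yoneda–exterior algebra
on `⊕ Extⁱ(E, E ⊗ Ω^j)`); the identity `Tr(x · id) = rank · x` on `Ext` (its sheaf-level form
`trace_app_overScalar : tr(a · 𝟙) = rank · a` is proved in `LocallyFreeTrace.lean`; the `Ext`-level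
form needs the `Ext(𝒪, 𝒪)`-module structure on `Ext(E, E)`); bijectivity of `extToCohomology`;
an instance of `AtiyahTraceAlgebra` (all bidegrees).

## References

* R.-O. Buchweitz, H. Flenner, *A semiregularity map for modules and applications to
  deformations*, Compositio Math. 137 (2003), §1 (`σ_0`, `k`-semiregular), §4 (trace map,
  Def. 4.1), §5 (`I`-semiregular). [BuchweitzFlenner2003]
* R. Bandiera, E. Lepri, M. Manetti (2023), §1 (`τ_k(x) = ((-1)^k/k!) Tr(At(F)^k x)`). [BandieraLepriManetti2023]
* M. F. Atiyah, Trans. AMS 85 (1957), §4. [Atiyah1957]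
* R. Hartshorne, *Algebraic Geometry* (1977), III.2.6, III.6.3, III.6.7. [Hartshorne1977]
-/

noncomputable section

open CategoryTheory CategoryTheory.Abelian AlgebraicGeometry Opposite TopologicalSpace Limits

namespace Literature.AlgebraicGeometry.HodgeTheory

open Literature.AlgebraicGeometry.Modules Literature.AlgebraicGeometry.Motives

universe w u

variable {X : Scheme.{u}}

/-! ### From `Ext` of `𝒪_X`-modules to sheaf cohomology -/

section ToCohomology

/-- The cohomology class `1 ∈ H⁰(X, 𝒪_X)` of the unit section (Mathlib's `Sheaf.H.equiv₀` at the
terminal open `⊤`). [folklore] -/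
def oneClass (X : Scheme.{u}) : ((modulesToSheaf X).obj (unitModule X)).H 0 :=
  (Sheaf.H.equiv₀ ((modulesToSheaf X).obj (unitModule X)) isTerminalTop).symm
    (1 : X.presheaf.obj (op ⊤))

/-- `Ext`-groups of `𝒪_X`-modules exist (in `Type (u+1)`, Mathlib `HasExt.standard`: morphisms in
the derived category of any abelian category are `max u v`-small). The constructions below are
universe-polymorphic in the `Ext`-universe `w`; this instance (the same as
`HodgeTheory.Modules.hasExt` of `SemiregularityMap.lean`, a `Prop`) makes them elaborate without
further imports. [folklore] -/
instance hasExt_modules (X : Scheme.{u}) : HasExt.{u + 1} X.Modules := HasExt.standard _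

variable [HasExt.{w} X.Modules]

/-- **From `Ext` of `𝒪_X`-modules to sheaf cohomology**: the comparison map
`Extⁱ_{𝒪_X}(𝒪_X, G) → Hⁱ(X, G) = Extⁱ_{Ab(X)}(ℤ_X, G)` — forget the module structures (the exact
functor `Mod(𝒪_X) → Ab(X)`, Mathlib `Ext.mapExactFunctor`) and precompose with the unit section
`1 : ℤ_X → 𝒪_X` (Yoneda composition with the class of `1` in `H⁰(X, 𝒪_X)`). It is the morphism of
`δ`-functors which is the identity on `H⁰ = Γ`, i.e. the canonical isomorphism of Hartshorne
III.2.6 / III.6.3 (c) `Extⁱ(𝒪_X, G) ≅ Hⁱ(X, G)` (bijectivity is not proved here).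
[cite: Hartshorne1977, III.6.3 (c) and III.2.6] -/
def extToCohomology (G : X.Modules) (i : ℕ) :
    Ext.{w} (unitModule X) G i →+ ((modulesToSheaf X).obj G).H i :=
  ((oneClass X).precomp _ (zero_add i)).comp ((modulesToSheaf X).mapExtAddHom (unitModule X) G i)

/-- Unfolding `extToCohomology`. [folklore] -/
lemma extToCohomology_apply (G : X.Modules) (i : ℕ) (y : Ext.{w} (unitModule X) G i) :
    extToCohomology G i y = (oneClass X).comp (y.mapExactFunctor (modulesToSheaf X)) (zero_add i) :=
  rfl

/-- `extToCohomology` is natural in `G`: it commutes with post-composition by a morphism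
`g : G → G'` (on cohomology: `Sheaf.H.map`). [folklore] -/
lemma extToCohomology_comp_mk₀ {G G' : X.Modules} (g : G ⟶ G') (i : ℕ)
    (y : Ext.{w} (unitModule X) G i) :
    extToCohomology G' i (y.comp (Ext.mk₀ g) (add_zero i)) =
      (extToCohomology G i y).comp (Ext.mk₀ ((modulesToSheaf X).map g)) (add_zero i) := by
  rw [extToCohomology_apply, extToCohomology_apply, Ext.mapExactFunctor_comp,
    Ext.mapExactFunctor_mk₀]
  exact (Ext.comp_assoc_of_third_deg_zero _ _ _ _).symm

end ToCohomology

/-! ### The trace on `Ext`: `Extⁱ(E, E) → Hⁱ(X, 𝒪_X)` and `Extⁱ(E, 𝓗om(E^∨, G)) → Hⁱ(X, G)` -/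

section TraceExt

variable [HasExt.{w} X.Modules] {E : X.Modules} (hE : IsFiniteLocallyFree E)

/-- **The trace with coefficients on `Ext`**, for `E` finite locally free and any `𝒪_X`-module `G`:
`Tr_G : Extⁱ(E, 𝓗om(E^∨, G)) → Extⁱ(𝒪_X, G)` (`𝓗om(E^∨, G) ≅ E ⊗ G`), the composite
`Extⁱ(E, 𝓗om(E^∨,G)) → Extⁱ(𝓔nd E, 𝓗om(E, 𝓗om(E^∨,G)))` (the EXACT functor `𝓗om(E, –)`,
`preservesFiniteColimits_sheafHomFunctor`) `→ Extⁱ(𝒪_X, 𝓗om(E, 𝓗om(E^∨,G)))` (unit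
`𝒪_X → 𝓔nd E`) `→ Extⁱ(𝒪_X, G)` (contraction `c_G`). This is the adjunction isomorphism
`Extⁱ(E, E ⊗ G) ≅ Extⁱ(𝒪_X, E^∨ ⊗ E ⊗ G)` (Hartshorne III.6.7) followed by the evaluation
`E^∨ ⊗ E → 𝒪_X`: Illusie's / Buchweitz–Flenner's `Tr : Ext^k(F, F ⊗ G) → H^k(X, G)` for a vector
bundle `F`. [cite: BuchweitzFlenner2003, §4 (trace map, "see [Ill]")] [cite: Hartshorne1977, III.6.7] -/
def traceExtCoeff (G : X.Modules) (i : ℕ) :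
    Ext.{w} E (sheafHom (dual E) G) i →+ Ext.{w} (unitModule X) G i :=
  haveI := preservesFiniteColimits_sheafHomFunctor E hE
  ((Ext.mk₀ (sheafHomUnit E)).precomp G (zero_add i)).comp
    (((Ext.mk₀ (contract hE G)).postcomp (sheafHom E E) (add_zero i)).comp
      ((sheafHomFunctor E).mapExtAddHom E (sheafHom (dual E) G) i))

/-- Unfolding `traceExtCoeff`. [folklore] -/
lemma traceExtCoeff_apply (G : X.Modules) (i : ℕ) (x : Ext.{w} E (sheafHom (dual E) G) i) :
    traceExtCoeff hE G i x =
      haveI := preservesFiniteColimits_sheafHomFunctor E hE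
      (Ext.mk₀ (sheafHomUnit E)).comp
        ((x.mapExactFunctor (sheafHomFunctor E)).comp (Ext.mk₀ (contract hE G)) (add_zero i))
        (zero_add i) :=
  rfl

/-- `Extⁱ(E, E) → Extⁱ(E, E^∨∨) = Extⁱ(E, 𝓗om(E^∨, 𝒪_X))` (post-composition with biduality).
[folklore] -/
def extToBidual (E : X.Modules) (i : ℕ) :
    Ext.{w} E E i →+ Ext.{w} E (sheafHom (dual E) (unitModule X)) i :=
  (Ext.mk₀ (toBidual E (unitModule X))).postcomp E (add_zero i)

/-- **The trace on `Ext`**: `Tr : Extⁱ_{𝒪_X}(E, E) → Extⁱ_{𝒪_X}(𝒪_X, 𝒪_X)` for `E` finite locally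
free — `𝓗om(E, –)`, the unit `𝒪_X → 𝓔nd(E)` and the trace `tr : 𝓔nd(E) → 𝒪_X`
(equivalently `traceExtCoeff 𝒪_X ∘ extToBidual`, `traceExt_eq`). [cite: BuchweitzFlenner2003, §4 (trace map)] -/
def traceExt (i : ℕ) : Ext.{w} E E i →+ Ext.{w} (unitModule X) (unitModule X) i :=
  haveI := preservesFiniteColimits_sheafHomFunctor E hE
  ((Ext.mk₀ (sheafHomUnit E)).precomp (unitModule X) (zero_add i)).comp
    (((Ext.mk₀ (trace hE)).postcomp (sheafHom E E) (add_zero i)).comp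
      ((sheafHomFunctor E).mapExtAddHom E E i))

/-- Unfolding `traceExt`. [folklore] -/
lemma traceExt_apply (i : ℕ) (x : Ext.{w} E E i) :
    traceExt hE i x =
      haveI := preservesFiniteColimits_sheafHomFunctor E hE
      (Ext.mk₀ (sheafHomUnit E)).comp
        ((x.mapExactFunctor (sheafHomFunctor E)).comp (Ext.mk₀ (trace hE)) (add_zero i))
        (zero_add i) :=
  rfl

/-- The trace on `Ext` is the trace with coefficients `𝒪_X` after biduality. [folklore] -/
theorem traceExt_eq (i : ℕ) (x : Ext.{w} E E i) :
    traceExt hE i x = traceExtCoeff hE (unitModule X) i (extToBidual E i x) := by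
  haveI := preservesFiniteColimits_sheafHomFunctor E hE
  rw [traceExt_apply, traceExtCoeff_apply]
  change _ = (Ext.mk₀ (sheafHomUnit E)).comp (((x.comp (Ext.mk₀ (toBidual E (unitModule X)))
      (add_zero i)).mapExactFunctor (sheafHomFunctor E)).comp (Ext.mk₀ (contract hE _))
        (add_zero i)) (zero_add i)
  rw [Ext.mapExactFunctor_comp, Ext.mapExactFunctor_mk₀]
  refine congrArg (fun z => (Ext.mk₀ (sheafHomUnit E)).comp z (zero_add i)) ?_
  refine Eq.trans ?_ (Ext.comp_assoc_of_third_deg_zero _ _ _ _).symm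
  exact congrArg (fun z => (x.mapExactFunctor (sheafHomFunctor E)).comp z (add_zero i))
    (Ext.mk₀_comp_mk₀ _ _).symm

/-- **The trace to sheaf cohomology**: `Extⁱ_{𝒪_X}(E, E) → Hⁱ(X, 𝒪_X)`
(`= Motives.structureSheafCohomology X i`), for `E` finite locally free; in degree `2` this is the
component `σ_0` of the Buchweitz–Flenner semiregularity map ("`σ_0 : Ext²_X(F, F) → H²(X, 𝒪_X)`
[is] the map between obstruction spaces for the deformations of `F` versus those of its determinant",
Artamkin–Mukai). [cite: BuchweitzFlenner2003, §1 (σ_0) and Def. 4.1] -/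
def traceToCohomology (i : ℕ) : Ext.{w} E E i →+ structureSheafCohomology X i :=
  (extToCohomology (unitModule X) i).comp (traceExt hE i)

/-- **The trace with coefficients to sheaf cohomology**: `Extⁱ(E, 𝓗om(E^∨, G)) → Hⁱ(X, G)`.
[cite: BuchweitzFlenner2003, §4 (trace map)] -/
def traceCoeffToCohomology (G : X.Modules) (i : ℕ) :
    Ext.{w} E (sheafHom (dual E) G) i →+ ((modulesToSheaf X).obj G).H i :=
  (extToCohomology G i).comp (traceExtCoeff hE G i)

end TraceExt

/-! ### The semiregularity components `σ_0`, `σ_1` on real carriers -/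

section Sigma

variable {S : Type u} [CommRing S] {X : Over (Spec (CommRingCat.of S))}
  [HasExt.{w} X.left.Modules] {E : X.left.Modules} (hE : IsFiniteLocallyFree E)

/-- **`σ_0 = Tr : Ext²_{𝒪_X}(E, E) → H²(X, 𝒪_X)`**, the degree-`0` component of the
Buchweitz–Flenner semiregularity map of a finite locally free `E`, on real carriers (Mathlib's
`Ext` in `X.Modules`, the tree's `Motives.structureSheafCohomology`).
[cite: BuchweitzFlenner2003, §1 (σ_0) and Def. 4.1] -/
def sigmaZero : Ext.{w} E E 2 →+ structureSheafCohomology X.left 2 :=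
  traceToCohomology hE 2

/-- **`σ_1 : Ext²_{𝒪_X}(E, E) → H³(X, Ω¹_{X/S})`**, `σ_1(x) = Tr(At(E) ∘ x)`: compose with the Atiyah
class (`Ext²(E, E) → Ext³(E, E ⊗ Ω¹)`), then the trace with coefficients `Ω¹`
(`traceCoeffToCohomology`), landing in the tree's `Motives.hodgeCohomologyOne X 3`. This is the
degree-`1` component of `σ = Tr(∗ · exp(-At))` up to the sign `-1` of `exp(-At)` in degree one
(BLM: `τ_1(x) = -Tr(At(F) x)`); injectivity is insensitive to the sign.
[cite: BuchweitzFlenner2003, Def. 4.1] [cite: BandieraLepriManetti2023, §1 (τ_k)] -/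
def sigmaOne : Ext.{w} E E 2 →+ hodgeCohomologyOne X 3 :=
  (traceCoeffToCohomology hE (cotangentSheaf X) 3).comp
    ((atiyahClass E).postcomp E (rfl : 2 + 1 = 3))

/-- Unfolding `σ_1`: `σ_1(x) = Tr_{Ω¹}(x ∘ At(E))` (Yoneda composite `E → E[2] → (E ⊗ Ω¹)[3]`).
[cite: BuchweitzFlenner2003, Def. 4.1] -/
lemma sigmaOne_apply (x : Ext.{w} E E 2) :
    sigmaOne hE x = traceCoeffToCohomology hE (cotangentSheaf X) 3
      (x.comp (atiyahClass E) (rfl : 2 + 1 = 3)) := rfl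

/-- **`E` is `0`-semiregular**: `σ_0 = Tr : Ext²(E, E) → H²(X, 𝒪_X)` is injective (Mukai–Artamkin).
[cite: BuchweitzFlenner2003, §1 (k-semiregular)] -/
def IsZeroSemiregular {E : X.left.Modules} (hE : IsFiniteLocallyFree E) : Prop :=
  Function.Injective (sigmaZero.{w} hE)

/-- **`E` is `1`-semiregular**: `σ_1 : Ext²(E, E) → H³(X, Ω¹)` is injective.
[cite: BuchweitzFlenner2003, §1 (k-semiregular)] -/
def IsOneSemiregular {E : X.left.Modules} (hE : IsFiniteLocallyFree E) : Prop :=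
  Function.Injective (sigmaOne.{w} hE)

/-- **`E` is `{0, 1}`-semiregular**: `(σ_0, σ_1) : Ext²(E, E) → H²(X, 𝒪_X) × H³(X, Ω¹_{X/S})` is
injective (the part of BF's `I`-semiregularity, `I = {0, 1}` in form degrees, that has real
carriers today; `Ω^q` for `q ≥ 2` awaits `defn-HodgeSheavesOmega`).
[cite: BuchweitzFlenner2003, §5 (I-semiregular)] -/
def IsZeroOneSemiregular {E : X.left.Modules} (hE : IsFiniteLocallyFree E) : Prop :=
  Function.Injective fun x : Ext.{w} E E 2 => (sigmaZero hE x, sigmaOne hE x)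

/-- Unfolding `σ_0`: the trace on `Ext²` followed by the comparison with sheaf cohomology.
[cite: BuchweitzFlenner2003, §1 (σ_0)] -/
lemma sigmaZero_apply (x : Ext.{w} E E 2) :
    sigmaZero hE x = extToCohomology (unitModule X.left) 2 (traceExt hE 2 x) := rfl

/-- `{0,1}`-semiregularity as a joint-kernel condition: `σ_0(x) = 0 ∧ σ_1(x) = 0 ⇒ x = 0`.
[cite: BuchweitzFlenner2003, §5 (I-semiregular)] -/
theorem isZeroOneSemiregular_iff :
    IsZeroOneSemiregular hE ↔ ∀ x : Ext.{w} E E 2, sigmaZero hE x = 0 → sigmaOne hE x = 0 → x = 0 := by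
  constructor
  · intro h x h0 h1
    exact h (show (sigmaZero hE x, sigmaOne hE x) = (sigmaZero hE 0, sigmaOne hE 0) by
      rw [h0, h1, map_zero, map_zero])
  · intro h x y hxy
    have h0 : sigmaZero hE (x - y) = 0 := by
      rw [map_sub, sub_eq_zero]; exact congrArg Prod.fst hxy
    have h1 : sigmaOne hE (x - y) = 0 := by
      rw [map_sub, sub_eq_zero]; exact congrArg Prod.snd hxy
    exact sub_eq_zero.mp (h _ h0 h1)

/-- `0`-semiregular implies `{0,1}`-semiregular. [cite: BuchweitzFlenner2003, §5] -/
lemma IsZeroSemiregular.isZeroOneSemiregular (h : IsZeroSemiregular hE) :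
    IsZeroOneSemiregular hE := fun _ _ hxy => h (congrArg Prod.fst hxy)

/-- `1`-semiregular implies `{0,1}`-semiregular. [cite: BuchweitzFlenner2003, §5] -/
lemma IsOneSemiregular.isZeroOneSemiregular (h : IsOneSemiregular hE) :
    IsZeroOneSemiregular hE := fun _ _ hxy => h (congrArg Prod.snd hxy)

end Sigma

end Literature.AlgebraicGeometry.HodgeTheory

end
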